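import Literature.Geometry.Riemannian.HessianBound
import Literature.Geometry.Riemannian.VolumeSphereTheoremProofs
import HarnessLib

/-!
# Integrating a Hessian pinching along a geodesic: `f ∘ γ` versus `f(γ₀) cos t + f'(γ₀) sin t`

Step "(iii), per geodesic" of the `L²`-Toponogov theorem in Colding's proof of the volume sphere
theorem (`Colding1996_volume_ghClose`; Colding 1996, Invent. Math. 124, §1, and Colding 1997,
*Aspects of Ricci curvature*, sketch of the proof of Thm. 1.1, p. 88: "By integrating this
[`|Hess f + fg|` small in `L²`] along geodesics we can show the theorem for `f`"). For a smooth
function `f` and a unit-speed geodesic `γ` of the Levi-Civita connection of a smooth Riemannian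
metric `g`, the function `u = f ∘ γ` satisfies `u'' + u = (Hess f + f g)(γ', γ')`
(`hasDerivAt_mvfderiv_velocity_of_isGeodesicOn`: the second derivative along a geodesic is the
Hessian; `g(γ', γ') ≡ 1`), so that the stability estimate for `u'' + u = h` of
`VolumeSphereTheoremProofs.lean` §12 (`abs_sub_cos_sin_le_integral_abs`) gives, for `t ≥ 0`,

  `|f(γ t) − f(γ 0) cos t − df(γ' 0) sin t| ≤ ∫₀ᵗ |(Hess f + f g)_{γ s}(γ' s, γ' s)| ds`

and the same bound for `|df(γ' t) − (−f(γ 0) sin t + df(γ' 0) cos t)|`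
(`abs_comp_geodesic_sub_cos_sin_le`). On the round sphere `cos d_p` satisfies
`Hess f + f g = 0`, and these are the spherical law of cosines along `γ`; Colding's theorem averages
the right-hand side over the Liouville measure (not formalised here). No definitions, no named
facts (D-0026).

## References

* T. H. Colding, *Shape of manifolds with positive Ricci curvature*, Invent. Math. 124 (1996),
  175–191, §1. [Colding1996Shape]
* T. H. Colding, *Aspects of Ricci curvature*, in: Comparison Geometry, MSRI Publ. 30 (1997),
  sketch of the proof of Thm. 1.1, p. 88 (read: `lit read book:grove1997-comparison-geometry`,
  PDF p. 111). [Colding1997Aspects]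
* B. O'Neill, *Semi-Riemannian Geometry*, Academic Press 1983, Ch. 3, Def. 3.48–Lemma 3.49
  (Hessian), p. 69 (constant speed of geodesics). [ONeill1983]
-/

noncomputable section

open Bundle Set Function Filter Manifold MeasureTheory
open scoped Manifold ContDiff Topology

namespace Literature.Geometry.Riemannian

open Literature.Geometry.Lorentzian
open Literature.Geometry.Lorentzian.PseudoRiemannianMetric

variable {E : Type*} [NormedAddCommGroup E] [NormedSpace ℝ E] {H : Type*} [TopologicalSpace H]
  {I : ModelWithCorners ℝ E H} {M : Type*} [TopologicalSpace M] [ChartedSpace H M]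
  [IsManifold I ∞ M] [FiniteDimensional ℝ E] [CompleteSpace E]
  (g : PseudoRiemannianMetric I ∞ E (TangentSpace I : M → Type _)) [g.HasLeviCivita]

/-- **Integrating a Hessian pinching along a unit-speed geodesic** (Colding 1997, sketch of the
proof of Thm. 1.1: "By integrating this along geodesics we can show the theorem for `f`"). Let
`g` be a smooth pseudo-Riemannian metric with its Levi-Civita connection, `f ∈ C^∞(M)`, and
`γ : ℝ → M` a geodesic with `g(γ'(0), γ'(0)) = 1`. Then for every `t ≥ 0`

  `|f(γ t) − (f(γ 0) cos t + df(γ' 0) sin t)| ≤ ∫₀ᵗ |Hess f(γ' s, γ' s) + f(γ s) g(γ' s, γ' s)| ds`,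
  `|df(γ' t) − (−f(γ 0) sin t + df(γ' 0) cos t)| ≤ ∫₀ᵗ |Hess f(γ' s, γ' s) + f(γ s) g(γ' s, γ' s)| ds`,

the integrand being `|(Hess f + f g)(γ', γ')|` along `γ`. Proof: `u = f ∘ γ` has
`u' = df(γ')` (`hasDerivAt_comp_curve_mvfderiv`) and `u'' = Hess f(γ', γ')`
(`hasDerivAt_mvfderiv_velocity_of_isGeodesicOn`), `g(γ', γ') ≡ 1` (`IsGeodesic.val_velocity_eq`),
the Hessian quadratic form is continuous along the tangent lift (`continuous_hessian_quadratic`),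
and `abs_sub_cos_sin_le_integral_abs` (stability of `u'' + u = h`).
[cite: Colding1997Aspects, sketch of the proof of Thm. 1.1 (p. 88)] [cite: Colding1996Shape, §1] -/
theorem abs_comp_geodesic_sub_cos_sin_le {f : M → ℝ} (hf : CMDiff ∞ f) {γ : ℝ → M}
    (hγ : IsGeodesic g.leviCivita γ) (hunit : g.val (γ 0) (velocity I γ 0) (velocity I γ 0) = 1)
    {t : ℝ} (ht : 0 ≤ t) :
    |f (γ t) - (f (γ 0) * Real.cos t + mvfderiv I f (γ 0) (velocity I γ 0) * Real.sin t)| ≤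
        ∫ s in (0:ℝ)..t, |g.hessian f (γ s) (velocity I γ s) (velocity I γ s) +
          f (γ s) * g.val (γ s) (velocity I γ s) (velocity I γ s)| ∧
      |mvfderiv I f (γ t) (velocity I γ t) -
          (-f (γ 0) * Real.sin t + mvfderiv I f (γ 0) (velocity I γ 0) * Real.cos t)| ≤
        ∫ s in (0:ℝ)..t, |g.hessian f (γ s) (velocity I γ s) (velocity I γ s) +
          f (γ s) * g.val (γ s) (velocity I γ s) (velocity I γ s)| := by
  haveI : Fact (1 ≤ (∞ : ℕ∞ω)) := ⟨by exact_mod_cast le_top⟩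
  have hγon : IsGeodesicOn g.leviCivita γ univ := hγ
  -- `u = f ∘ γ`, `u' = df(γ')`, `u'' = Hess f(γ', γ')`
  set u : ℝ → ℝ := fun s ↦ f (γ s) with hu_def
  set u' : ℝ → ℝ := fun s ↦ mvfderiv I f (γ s) (velocity I γ s) with hu'_def
  set u'' : ℝ → ℝ := fun s ↦ g.hessian f (γ s) (velocity I γ s) (velocity I γ s) with hu''_def
  have hlift : ∀ s, MDifferentiableAt 𝓘(ℝ, ℝ) I.tangent (tangentLift I γ) s := fun s ↦
    hγon.1 s (mem_univ s)
  have hγd : ∀ s, MDifferentiableAt 𝓘(ℝ, ℝ) I γ s := fun s ↦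
    mdifferentiableAt_of_mdifferentiableAt_lift (hlift s)
  have hu : ∀ s, HasDerivAt u (u' s) s := fun s ↦
    hasDerivAt_comp_curve_mvfderiv ((hf (γ s)).mdifferentiableAt (by simp)) (hγd s)
  have hu' : ∀ s, HasDerivAt u' (u'' s) s := fun s ↦
    g.hasDerivAt_mvfderiv_velocity_of_isGeodesicOn hγon (mem_univ s)
      ((hf (γ s)).of_le (WithTop.coe_le_coe.mpr le_top))
  have huc : Continuous u := continuous_iff_continuousAt.2 fun s ↦ (hu s).continuousAt
  have hu'c : Continuous u' := continuous_iff_continuousAt.2 fun s ↦ (hu' s).continuousAt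
  -- `u''` is continuous: the Hessian quadratic form on `TM` along the continuous tangent lift
  have hliftc : Continuous (tangentLift I γ) :=
    continuous_iff_continuousAt.2 fun s ↦ (hlift s).continuousAt
  have hu''c : Continuous u'' := by
    have h1 := (GGSU.continuous_hessian_quadratic g hf).comp hliftc
    exact h1
  -- unit speed all along
  have hspeed : ∀ s, g.val (γ s) (velocity I γ s) (velocity I γ s) = 1 := fun s ↦ by
    rw [hγ.val_velocity_eq g s 0, hunit]
  -- the stability estimate for `u'' + u`
  have key := abs_sub_cos_sin_le_integral_abs (l := t) huc.continuousOn hu'c.continuousOn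
    (fun s _ ↦ hu s) (fun s _ ↦ hu' s) (hu''c.add huc).continuousOn t ⟨ht, le_rfl⟩
  have hint : ∫ s in (0:ℝ)..t, |u'' s + u s| =
      ∫ s in (0:ℝ)..t, |g.hessian f (γ s) (velocity I γ s) (velocity I γ s) +
        f (γ s) * g.val (γ s) (velocity I γ s) (velocity I γ s)| := by
    refine intervalIntegral.integral_congr fun s _ ↦ ?_
    simp only [hu''_def, hu_def, hspeed s, mul_one]
  rw [hint] at key
  exact key

end Literature.Geometry.Riemannian

end
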